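import Summits.QuantumFields.YangMills.Theorems.LuscherReductionDressedRitzPolyakovLiftBlockLeakage
import Summits.QuantumFields.YangMills.Theorems.FemtoTransferGapBlockToFineCross
import HarnessLib

/-!
# Route `LuscherReduction`, item `DressedRitz` (stmt-QuantumFields-20205), line «polyakovlift» r8 — POSITION IN BLOCK CURRENCY:
# the text `BlockPositionForL P` and the root-extraction glue for (o5) ∕ the triangle glue for (o6) (LEAD prover ym-lead-20205-polyakovlift g4)

In r8 the ∃-basis POSITION `LiftPositionForL P` ((o5) Lüscher position at `e^{±Cλ²/L}`, (o6) symmetrised couplings at `Cλ²/L`) is derived from S-UNIV′ ∧ S-PSCAL″.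
The block-to-fine doors (`FemtoTransferGapBlockToFine`, `…BlockToFineCross`) open a SECOND, block-native source: the `L`-FREE text

* `BlockPositionForL P` (NEW, ∃-basis, same shell as `LiftPositionForL`): for the dressed lifted family `u_i = K^{L} v_i` (block `P = K^{L}`, `L = dressSteps L`):
  (B5) `⟨u_i,Pu_i⟩·μ₀^L = e^{±Cλ²}·(μ_{i+1}λ₀)^L·‖u_i‖²` — the BLOCK Rayleigh quotient equals the `L`-th power of the one-site level ratio (times `λ₀^L`) to `L`-free
  relative precision `λ²` (an effective mass over one block vs a NUMBER known from the closed crux ONE);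
  (B6) `|⟨u_i,Pu_l⟩ − ((X̃_i+X̃_l)/2)·⟨u_i,u_l⟩| ≤ Cλ²·λ₀^L·‖u_i‖‖u_l‖`, `X̃ = ⟨u,Pu⟩/‖u‖²` — block cross data, `L`-free precision `λ²`;
* ★ `o5_of_block` (pure real ROOT EXTRACTION): (B5) for one vector + doors (a)(b) (`d^L ≤ X̃n^{L−1} ≤ e^{15δ}d^L`) ⟹ the FINE (o5) pair
  `d·μ₀ ≤ e^{Cλ²/L}·μ_{i+1}λ₀·n` and `μ_{i+1}λ₀·n ≤ e^{(Cλ²+15δ)/L}·d·μ₀`;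
* ★ `o6_of_block` (pure real TRIANGLE): (B6) + the cross door's conclusion + a bound on the centre mismatch `|X₀ − M̄|` ⟹ the FINE (o6) bound.

What remains for `LiftPositionForL P ⟸ BlockPositionForL P ∧ BlockLeakageForL P` is the quantifier shell plus the door side conditions (`Θ`-comparability of the
block quotients and the `O(λ²)` mismatch of two channels' block quotients), which follow from (B5) and the one-site level package `PScal.levels_package` (closed crux ONE);
typed as the next step (w1a WAKE W4-A).

HONEST FRAMING: a typed block-currency text and two algebraic glue lemmas on the CONDITIONAL femto rung R2b1; `BlockPositionForL (TransplantBasisLR k)` is an OPEN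
renormalisation-group estimate (not in print); nothing here bears on infinite volume, the continuum limit or the Clay gap.
References: M. Lüscher, NPB 219 (1983) 233 [cite: Luscher1983, §3]; M. Lüscher, U. Wolff, NPB 339 (1990) 222 [cite: LuscherWolff1990].
-/

set_option autoImplicit false

noncomputable section

open MeasureTheory Filter Topology Real
open Literature.MathematicalPhysics.QuantumFieldTheory (GaugeConfig Site gaugeTransform)
open scoped BigOperators

namespace Summit.QuantumFields.YangMills.Theorems.FemtoTransferGap.PolyakovLift

open Summit.QuantumFields.YangMills.Theorems.FemtoTransferGap

variable {k : ℕ}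

/-! ## §1 The block-currency text of POSITION -/

/-- **BLOCK-POSITION for the basis predicate `P`** (∃-basis): along the femto window, for every raw vacuum there is a basis in `P` whose DRESSED lifted family
`u_i = K^{L} v_i` satisfies, with the block `P = K^{L}` (`L = dressSteps L`), `λ₀ = levelValue L β 0`, `μ_j = levelValue 1 (oneSiteCoupling β L) j`:
(B5) `⟨u_i,Pu_i⟩·μ₀^L ≤ e^{Cλ²}(μ_{i+1}λ₀)^L‖u_i‖²` and `(μ_{i+1}λ₀)^L‖u_i‖² ≤ e^{Cλ²}⟨u_i,Pu_i⟩·μ₀^L`;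
(B6) `|⟨u_i,Pu_l⟩ − ((⟨u_i,Pu_i⟩/‖u_i‖² + ⟨u_l,Pu_l⟩/‖u_l‖²)/2)·⟨u_i,u_l⟩| ≤ Cλ²·λ₀^L·‖u_i‖‖u_l‖` (`i ≠ l`).
Block-aligned two-point data at Euclidean times `2L, 3L`, `L`-FREE relative precision `λ²`. OPEN (RG). [cite: Luscher1983, §3] [cite: LuscherWolff1990] -/
def BlockPositionForL (P : ℕ → ℝ → (Fin k → (GaugeConfig 3 1 SU2 → ℝ)) → Prop) : Prop :=
  ∃ C lam0 : ℝ, 0 ≤ C ∧ 0 < lam0 ∧ ∀ lam : ℝ, 0 < lam → lam ≤ lam0 → ∃ L0 : ℕ,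
    ∀ (L : ℕ) [NeZero L], L0 ≤ L → ∀ β : ℝ, InFemtoWindow lam β L →
      ∀ φ : GaugeConfig 3 L SU2 → ℝ, IsRawVacuum β φ →
        ∃ g : Fin k → (GaugeConfig 3 1 SU2 → ℝ), P L (luscherLambda β L) g ∧
          let u := dressedLiftFamily β φ g
          let l0 := levelValue su2Rep L β 0
          let m0 := levelValue su2Rep 1 (oneSiteCoupling β L) 0
          (∀ i : Fin k,
            l2 (u i) ((transferApply β)^[dressSteps L] (u i)) * m0 ^ dressSteps L ≤
                Real.exp (C * luscherLambda β L ^ 2) *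
                  ((levelValue su2Rep 1 (oneSiteCoupling β L) ((i : ℕ) + 1) * l0) ^ dressSteps L) * l2 (u i) (u i) ∧
            (levelValue su2Rep 1 (oneSiteCoupling β L) ((i : ℕ) + 1) * l0) ^ dressSteps L * l2 (u i) (u i) ≤
                Real.exp (C * luscherLambda β L ^ 2) * (l2 (u i) ((transferApply β)^[dressSteps L] (u i)) * m0 ^ dressSteps L)) ∧
          (∀ i l : Fin k, i ≠ l →
            |l2 (u i) ((transferApply β)^[dressSteps L] (u l)) -
                (l2 (u i) ((transferApply β)^[dressSteps L] (u i)) / l2 (u i) (u i) +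
                    l2 (u l) ((transferApply β)^[dressSteps L] (u l)) / l2 (u l) (u l)) / 2 * l2 (u i) (u l)|
              ≤ C * luscherLambda β L ^ 2 * l0 ^ dressSteps L * (Real.sqrt (l2 (u i) (u i)) * Real.sqrt (l2 (u l) (u l))))

/-! ## §2 ★ Root extraction: (B5) + doors (a)(b) ⟹ fine (o5) -/

/-- `L`-th ROOT MONOTONICITY: `x^L ≤ y^L`, `x, y ≥ 0`, `L ≥ 1` ⟹ `x ≤ y`. [folklore] -/
theorem le_of_pow_le_pow_left' {x y : ℝ} (hx : 0 ≤ x) (hy : 0 ≤ y) {L : ℕ} (hL : 1 ≤ L) (h : x ^ L ≤ y ^ L) : x ≤ y :=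
  (pow_le_pow_iff_left₀ hx hy (by omega)).1 h

/-- ★ **(o5) FROM BLOCK POSITION AND THE DOORS** (pure real, one channel).  Data: fine `d = ⟨u,Ku⟩ ≥ 0`, norm `n > 0`, block `X = ⟨u,K^Lu⟩`, one-site `μ₀ > 0`,
`μ ≥ 0` (the target level), `λ₀ ≥ 0`; doors (a) `d^L ≤ X·n^{L−1}` and (b) `X·n^{L−1} ≤ e^{b}·d^L`; block position (B5) `X·μ₀^L ≤ e^{a}(μλ₀)^L n` and
`(μλ₀)^L n ≤ e^{a}·X·μ₀^L`.  THEN `d·μ₀ ≤ e^{a/L}·(μλ₀)·n` and `(μλ₀)·n ≤ e^{(a+b)/L}·d·μ₀`. [cite: Luscher1983, §3] -/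
theorem o5_of_block {d n X m0 μ l0 a b : ℝ} {L : ℕ} (hL : 1 ≤ L) (hd : 0 ≤ d) (hn : 0 < n) (hm0 : 0 < m0) (hμ : 0 ≤ μ) (hl0 : 0 ≤ l0)
    (hdoorA : d ^ L ≤ X * n ^ (L - 1)) (hdoorB : X * n ^ (L - 1) ≤ Real.exp b * d ^ L)
    (hB5up : X * m0 ^ L ≤ Real.exp a * (μ * l0) ^ L * n) (hB5lo : (μ * l0) ^ L * n ≤ Real.exp a * (X * m0 ^ L)) :
    d * m0 ≤ Real.exp (a / L) * (μ * l0) * n ∧ (μ * l0) * n ≤ Real.exp ((a + b) / L) * (d * m0) := by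
  have hLpos : (0 : ℝ) < L := by exact_mod_cast hL
  obtain ⟨m, rfl⟩ : ∃ m, L = m + 1 := ⟨L - 1, by omega⟩
  rw [Nat.add_sub_cancel] at hdoorA hdoorB
  have hexpa : Real.exp a = Real.exp (a / (m + 1 : ℕ)) ^ (m + 1) := by
    rw [← Real.exp_nat_mul]; congr 1; field_simp
  have hexpab : Real.exp (a + b) = Real.exp ((a + b) / (m + 1 : ℕ)) ^ (m + 1) := by
    rw [← Real.exp_nat_mul]; congr 1; field_simp
  constructor
  · -- (d m0)^L ≤ X n^m m0^L ≤ e^a (μ l0)^L n n^m = (e^{a/L} μ l0 n)^L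
    have h1 : (d * m0) ^ (m + 1) ≤ (Real.exp (a / (m + 1 : ℕ)) * (μ * l0) * n) ^ (m + 1) := by
      calc (d * m0) ^ (m + 1) = d ^ (m + 1) * m0 ^ (m + 1) := mul_pow _ _ _
        _ ≤ X * n ^ m * m0 ^ (m + 1) := mul_le_mul_of_nonneg_right hdoorA (pow_nonneg hm0.le _)
        _ = X * m0 ^ (m + 1) * n ^ m := by ring
        _ ≤ Real.exp a * (μ * l0) ^ (m + 1) * n * n ^ m := mul_le_mul_of_nonneg_right hB5up (pow_nonneg hn.le _)
        _ = (Real.exp (a / (m + 1 : ℕ)) * (μ * l0) * n) ^ (m + 1) := by rw [hexpa]; ring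
    exact le_of_pow_le_pow_left' (by positivity) (by positivity) (Nat.succ_le_succ (Nat.zero_le m)) h1
  · -- (μ l0 n)^L = (μ l0)^L n n^m ≤ e^a X m0^L n^m ≤ e^a e^b d^L m0^L
    have h1 : (μ * l0 * n) ^ (m + 1) ≤ (Real.exp ((a + b) / (m + 1 : ℕ)) * (d * m0)) ^ (m + 1) := by
      calc (μ * l0 * n) ^ (m + 1) = (μ * l0) ^ (m + 1) * n * n ^ m := by ring
        _ ≤ Real.exp a * (X * m0 ^ (m + 1)) * n ^ m := mul_le_mul_of_nonneg_right hB5lo (pow_nonneg hn.le _)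
        _ = Real.exp a * m0 ^ (m + 1) * (X * n ^ m) := by ring
        _ ≤ Real.exp a * m0 ^ (m + 1) * (Real.exp b * d ^ (m + 1)) := mul_le_mul_of_nonneg_left hdoorB (by positivity)
        _ = (Real.exp ((a + b) / (m + 1 : ℕ)) * (d * m0)) ^ (m + 1) := by rw [mul_pow, ← hexpab, Real.exp_add]; ring
    exact le_of_pow_le_pow_left' (by positivity) (by positivity) (Nat.succ_le_succ (Nat.zero_le m)) h1

/-! ## §3 ★ Triangle: (B6) + cross door + centre mismatch ⟹ fine (o6) -/

/-- ★ **(o6) FROM BLOCK CROSS DATA AND THE CROSS DOOR** (pure real triangle).  With the fine cross quantity `c`, the cross datum `Nab = ⟨u,u'⟩`, the block cross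
`Tab = ⟨u,Pu'⟩`, the fine centre power `X₀`, the block centre `M̄`:  the cross door `|c − κ(Tab − X₀Nab)| ≤ R` (`κ = m̄/(LX₀) ≥ 0`), the block clause (B6)
`|Tab − M̄·Nab| ≤ E`, and the centre mismatch `|X₀ − M̄|·|Nab| ≤ F` give `|c| ≤ κ(E + F) + R`. [folklore] -/
theorem o6_of_block {c κ Tab Nab X0 Mb R E F : ℝ} (hκ : 0 ≤ κ) (hdoor : |c - κ * (Tab - X0 * Nab)| ≤ R) (hB6 : |Tab - Mb * Nab| ≤ E)
    (hmis : |X0 - Mb| * |Nab| ≤ F) : |c| ≤ κ * (E + F) + R := by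
  have h1 : |Tab - X0 * Nab| ≤ E + F := by
    have hsplit : Tab - X0 * Nab = (Tab - Mb * Nab) - (X0 - Mb) * Nab := by ring
    rw [hsplit]
    calc |(Tab - Mb * Nab) - (X0 - Mb) * Nab| ≤ |Tab - Mb * Nab| + |(X0 - Mb) * Nab| := abs_sub _ _
      _ ≤ E + F := by rw [abs_mul]; exact add_le_add hB6 hmis
  have h2 : |κ * (Tab - X0 * Nab)| ≤ κ * (E + F) := by
    rw [abs_mul, abs_of_nonneg hκ]; exact mul_le_mul_of_nonneg_left h1 hκ
  calc |c| = |(c - κ * (Tab - X0 * Nab)) + κ * (Tab - X0 * Nab)| := by ring_nf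
    _ ≤ |c - κ * (Tab - X0 * Nab)| + |κ * (Tab - X0 * Nab)| := abs_add_le _ _
    _ ≤ R + κ * (E + F) := add_le_add hdoor h2
    _ = κ * (E + F) + R := by ring

/-- CENTRE MISMATCH (pure real): if `e^{−b}X ≤ y^L ≤ X` and `e^{−b}X' ≤ y'^L ≤ X'` (doors (a)(b) for the two channels) then the fine centre power
`((y+y')/2)^L` lies between `e^{−b}·min(X,X')` and `max(X,X')`. [folklore] -/
theorem centre_between {y y' X X' b : ℝ} {L : ℕ} (hy : 0 ≤ y) (hy' : 0 ≤ y')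
    (h1 : Real.exp (-b) * X ≤ y ^ L) (h2 : y ^ L ≤ X) (h1' : Real.exp (-b) * X' ≤ y' ^ L) (h2' : y' ^ L ≤ X') :
    Real.exp (-b) * min X X' ≤ ((y + y') / 2) ^ L ∧ ((y + y') / 2) ^ L ≤ max X X' := by
  have hE : 0 < Real.exp (-b) := Real.exp_pos _
  constructor
  · -- (y+y')/2 ≥ min y y'
    rcases le_total y y' with hle | hle
    · have hm : y ≤ (y + y') / 2 := by linarith
      calc Real.exp (-b) * min X X' ≤ Real.exp (-b) * X := mul_le_mul_of_nonneg_left (min_le_left _ _) hE.le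
        _ ≤ y ^ L := h1
        _ ≤ ((y + y') / 2) ^ L := pow_le_pow_left₀ hy hm L
    · have hm : y' ≤ (y + y') / 2 := by linarith
      calc Real.exp (-b) * min X X' ≤ Real.exp (-b) * X' := mul_le_mul_of_nonneg_left (min_le_right _ _) hE.le
        _ ≤ y' ^ L := h1'
        _ ≤ ((y + y') / 2) ^ L := pow_le_pow_left₀ hy' hm L
  · rcases le_total y y' with hle | hle
    · have hm : (y + y') / 2 ≤ y' := by linarith
      calc ((y + y') / 2) ^ L ≤ y' ^ L := pow_le_pow_left₀ (by positivity) hm L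
        _ ≤ X' := h2'
        _ ≤ max X X' := le_max_right _ _
    · have hm : (y + y') / 2 ≤ y := by linarith
      calc ((y + y') / 2) ^ L ≤ y ^ L := pow_le_pow_left₀ (by positivity) hm L
        _ ≤ X := h2
        _ ≤ max X X' := le_max_left _ _

end Summit.QuantumFields.YangMills.Theorems.FemtoTransferGap.PolyakovLift

end
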